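/- Free-seat work of EXTRA WIDTH SEAT `ym-line-cbag-p1-w5` (prover-ym-line-cbag-p1-w5-g3-0), route `EguchiKawaiDirectionLadder`
(ideator ym-idea-2, LINE 8), crux `TripleSmallBallMargin` (stmt-QuantumFields-27724), v7 S10-C prefab (A) asked by the LEAD:
PARTITION OF THE PAIR PRODUCT `∏_{j<k} f j k` of an `N × N` array along a block labelling `ℓ : Fin N → Fin (m+1)` (collar label
`Fin.last m`): the within-block pairs of block `c`, re-enumerated increasingly as `Fin n_c` (`Finset.orderEmbOfFin`), give exactly the
pair product of the re-indexed block (the shape of the Vandermonde / `pairFactor` products of `EntrywiseRigidity` on `UN n_c`), and all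
other pairs (cross-block or touching the collar) are bounded by a constant each.  Pure finite combinatorics, ROUTE-INDEPENDENT.
Nothing here bears on the Yang–Mills mass gap. -/
import Mathlib.Algebra.BigOperators.Fin
import Mathlib.Algebra.Order.BigOperators.Ring.Finset
import Mathlib.Analysis.SpecialFunctions.Pow.Real
import Mathlib.Data.Finset.Sort
import Mathlib.Order.Interval.Finset.Fin
import HarnessLib

/-!
# Route `EguchiKawaiDirectionLadder`: partition of pair products along a block labelling

Notation: `R = {(j,k) : j < k}` the increasing pairs of `Fin N`; for a finset `S ⊆ Fin N` with `S.card = n`,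
`ι = S.orderEmbOfFin h : Fin n ↪o Fin N` its increasing enumeration; for a labelling `ℓ : Fin N → Fin (m+1)` the block `c : Fin m` is
`S_c = {i | ℓ i = Fin.castSucc c}` (`n_c = S_c.card`, `ι_c`), the collar is `{ℓ = Fin.last m}`; a pair is WITHIN if `ℓ j = ℓ k ≠ last`.

* `prod_Ioi_eq_prod_pairs` — `∏_j ∏_{k ∈ Ioi j} f j k = ∏_{p ∈ R} f p.1 p.2`;
* `prod_pairs_mem_eq_prod_orderEmbOfFin` (A1, any finset) — `∏_{p ∈ R, p.1 ∈ S, p.2 ∈ S} f p.1 p.2 = ∏_{a : Fin n} ∏_{b ∈ Ioi a} f (ι a) (ι b)`;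
* `prod_within_eq_prod_blocks` — `∏_{p ∈ R within} f = ∏_{c : Fin m} ∏_{a} ∏_{b ∈ Ioi a} f (ι_c a) (ι_c b)`;
* `prod_pairs_eq_within_mul_rest`, `prod_Ioi_le_pow_mul_prod_blocks` (A2) — `∏_{j<k} f j k ≤ A^B · ∏_c ∏_{a<b} f (ι_c a) (ι_c b)` for
  `0 ≤ f ≤ A`, `B = #{p ∈ R : ¬ within p}`;
* `card_not_within_le` — `B ≤ X + |K|·N`, `X = #` labelled cross pairs (`j<k`, labels different, neither collar), `|K| = #{ℓ = last}`.

HONEST FRAMING: bookkeeping only; no estimate of the route is proved here.  The route bears on the barrier-ledger fact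
`EguchiKawaiBreakdown`; the Yang–Mills mass gap is NOT touched.
-/

set_option autoImplicit false

open Finset

namespace Summit.QuantumFields.YangMills.Theorems.EguchiKawaiDirectionLadder

namespace PairPartition

variable {N : ℕ}

/-! ### §1 Increasing pairs as a finset of `Fin N × Fin N` -/

/-- `∏_j ∏_{k ∈ Ioi j} f j k = ∏_{p : p.1 < p.2} f p.1 p.2`. -/
theorem prod_Ioi_eq_prod_pairs (f : Fin N → Fin N → ℝ) :
    ∏ j : Fin N, ∏ k ∈ Ioi j, f j k = ∏ p ∈ (univ : Finset (Fin N × Fin N)).filter (fun p => p.1 < p.2), f p.1 p.2 := by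
  rw [prod_finset_product' ((univ : Finset (Fin N × Fin N)).filter (fun p => p.1 < p.2)) univ (fun j => Ioi j)]
  intro p
  simp only [mem_filter, mem_univ, true_and, mem_Ioi]

/-- **(A1) for an arbitrary finset**: the increasing pairs inside `S` are enumerated by the increasing pairs of `Fin n` through
`ι = S.orderEmbOfFin h`: `∏_{p : p.1 < p.2, p.1 ∈ S, p.2 ∈ S} f p.1 p.2 = ∏_{a : Fin n} ∏_{b ∈ Ioi a} f (ι a) (ι b)`. -/
theorem prod_pairs_mem_eq_prod_orderEmbOfFin (S : Finset (Fin N)) {n : ℕ} (h : S.card = n) (f : Fin N → Fin N → ℝ) :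
    ∏ p ∈ (univ : Finset (Fin N × Fin N)).filter (fun p => p.1 < p.2 ∧ p.1 ∈ S ∧ p.2 ∈ S), f p.1 p.2 =
      ∏ a : Fin n, ∏ b ∈ Ioi a, f (S.orderEmbOfFin h a) (S.orderEmbOfFin h b) := by
  set ι := S.orderEmbOfFin h with hι
  rw [prod_Ioi_eq_prod_pairs (fun a b => f (ι a) (ι b))]
  -- the embedding of pairs
  set E : (Fin n × Fin n) ↪ (Fin N × Fin N) := ι.toEmbedding.prodMap ι.toEmbedding with hE
  have himage : ((univ : Finset (Fin n × Fin n)).filter (fun q => q.1 < q.2)).map E =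
      (univ : Finset (Fin N × Fin N)).filter (fun p => p.1 < p.2 ∧ p.1 ∈ S ∧ p.2 ∈ S) := by
    ext p
    simp only [mem_map, mem_filter, mem_univ, true_and, hE, Function.Embedding.prodMap, Function.Embedding.coeFn_mk]
    constructor
    · rintro ⟨q, hq, rfl⟩
      exact ⟨ι.lt_iff_lt.mpr hq, S.orderEmbOfFin_mem h q.1, S.orderEmbOfFin_mem h q.2⟩
    · rintro ⟨hlt, h1, h2⟩
      have hr := S.range_orderEmbOfFin h
      have h1' : p.1 ∈ Set.range ι := by rw [hι, hr]; exact h1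
      have h2' : p.2 ∈ Set.range ι := by rw [hι, hr]; exact h2
      obtain ⟨a, ha⟩ := h1'
      obtain ⟨b, hb⟩ := h2'
      refine ⟨(a, b), ?_, ?_⟩
      · have : ι a < ι b := by rw [ha, hb]; exact hlt
        exact ι.lt_iff_lt.mp this
      · ext <;> simp [ha, hb]
  rw [← himage, prod_map]
  rfl

/-! ### §2 Blocks of a labelling -/

variable {m : ℕ}

/-- The within-block pairs of block `c` are the increasing pairs inside `S_c = {ℓ = castSucc c}`. -/
theorem filter_within_block_eq (ℓ : Fin N → Fin (m + 1)) (c : Fin m) :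
    (univ : Finset (Fin N × Fin N)).filter (fun p => p.1 < p.2 ∧ ℓ p.1 = Fin.castSucc c ∧ ℓ p.2 = Fin.castSucc c) =
      (univ : Finset (Fin N × Fin N)).filter (fun p => p.1 < p.2 ∧
        p.1 ∈ univ.filter (fun i => ℓ i = Fin.castSucc c) ∧ p.2 ∈ univ.filter (fun i => ℓ i = Fin.castSucc c)) := by
  ext p
  simp only [mem_filter, mem_univ, true_and]

/-- **(A1) per block**: `∏_{j<k, ℓ j = ℓ k = castSucc c} f j k = ∏_{a : Fin n_c} ∏_{b ∈ Ioi a} f (ι_c a) (ι_c b)`. -/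
theorem prod_block_pairs_eq (ℓ : Fin N → Fin (m + 1)) (c : Fin m) {n : ℕ}
    (h : (univ.filter (fun i => ℓ i = Fin.castSucc c)).card = n) (f : Fin N → Fin N → ℝ) :
    ∏ p ∈ (univ : Finset (Fin N × Fin N)).filter (fun p => p.1 < p.2 ∧ ℓ p.1 = Fin.castSucc c ∧ ℓ p.2 = Fin.castSucc c),
        f p.1 p.2 =
      ∏ a : Fin n, ∏ b ∈ Ioi a,
        f ((univ.filter (fun i => ℓ i = Fin.castSucc c)).orderEmbOfFin h a)
          ((univ.filter (fun i => ℓ i = Fin.castSucc c)).orderEmbOfFin h b) := by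
  rw [filter_within_block_eq, prod_pairs_mem_eq_prod_orderEmbOfFin]

/-- **The within product splits over the blocks**:
`∏_{p : p.1 < p.2, ℓ p.1 = ℓ p.2 ≠ last} f = ∏_{c : Fin m} ∏_{p : p.1 < p.2, ℓ p.1 = ℓ p.2 = castSucc c} f`. -/
theorem prod_within_eq_prod_blocks_pairs (ℓ : Fin N → Fin (m + 1)) (f : Fin N → Fin N → ℝ) :
    ∏ p ∈ (univ : Finset (Fin N × Fin N)).filter (fun p => p.1 < p.2 ∧ (ℓ p.1 = ℓ p.2 ∧ ℓ p.1 ≠ Fin.last m)), f p.1 p.2 =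
      ∏ c : Fin m, ∏ p ∈ (univ : Finset (Fin N × Fin N)).filter
        (fun p => p.1 < p.2 ∧ ℓ p.1 = Fin.castSucc c ∧ ℓ p.2 = Fin.castSucc c), f p.1 p.2 := by
  set W := (univ : Finset (Fin N × Fin N)).filter (fun p => p.1 < p.2 ∧ (ℓ p.1 = ℓ p.2 ∧ ℓ p.1 ≠ Fin.last m)) with hW
  -- fibre over the common label `ℓ p.1 : Fin (m+1)`
  have hfib := prod_fiberwise W (fun p : Fin N × Fin N => ℓ p.1) (fun p => f p.1 p.2)
  rw [← hfib, Fin.prod_univ_castSucc]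
  -- the `last` fibre is empty
  have hlast : ∏ p ∈ W.filter (fun p => ℓ p.1 = Fin.last m), f p.1 p.2 = 1 := by
    refine prod_eq_one fun p hp => ?_
    simp only [hW, mem_filter, mem_univ, true_and] at hp
    exact absurd hp.2 hp.1.2.2
  rw [hlast, mul_one]
  refine prod_congr rfl fun c _ => ?_
  congr 1
  ext p
  simp only [hW, mem_filter, mem_univ, true_and]
  constructor
  · rintro ⟨⟨hlt, heq, -⟩, hc⟩
    exact ⟨hlt, hc, heq ▸ hc⟩
  · rintro ⟨hlt, h1, h2⟩
    exact ⟨⟨hlt, h1.trans h2.symm, h1 ▸ (Fin.castSucc_lt_last c).ne⟩, h1⟩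

/-- **The within product as block pair products**:
`∏_{p : p.1 < p.2, within} f = ∏_{c : Fin m} ∏_{a : Fin n_c} ∏_{b ∈ Ioi a} f (ι_c a) (ι_c b)` (`n_c`, `ι_c` from `orderEmbOfFin`). -/
theorem prod_within_eq_prod_blocks (ℓ : Fin N → Fin (m + 1)) (f : Fin N → Fin N → ℝ) :
    ∏ p ∈ (univ : Finset (Fin N × Fin N)).filter (fun p => p.1 < p.2 ∧ (ℓ p.1 = ℓ p.2 ∧ ℓ p.1 ≠ Fin.last m)), f p.1 p.2 =
      ∏ c : Fin m, ∏ a : Fin (univ.filter (fun i => ℓ i = Fin.castSucc c)).card, ∏ b ∈ Ioi a,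
        f ((univ.filter (fun i => ℓ i = Fin.castSucc c)).orderEmbOfFin rfl a)
          ((univ.filter (fun i => ℓ i = Fin.castSucc c)).orderEmbOfFin rfl b) := by
  rw [prod_within_eq_prod_blocks_pairs]
  exact prod_congr rfl fun c _ => prod_block_pairs_eq ℓ c rfl f

/-! ### §3 The partition and the bound (A2) -/

/-- **Partition**: `∏_{j<k} f j k = (∏_{p : ¬ within} f) · ∏_c ∏_{a<b} f (ι_c a) (ι_c b)`. -/
theorem prod_Ioi_eq_rest_mul_blocks (ℓ : Fin N → Fin (m + 1)) (f : Fin N → Fin N → ℝ) :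
    ∏ j : Fin N, ∏ k ∈ Ioi j, f j k =
      (∏ p ∈ (univ : Finset (Fin N × Fin N)).filter
          (fun p => p.1 < p.2 ∧ ¬ (ℓ p.1 = ℓ p.2 ∧ ℓ p.1 ≠ Fin.last m)), f p.1 p.2) *
        ∏ c : Fin m, ∏ a : Fin (univ.filter (fun i => ℓ i = Fin.castSucc c)).card, ∏ b ∈ Ioi a,
          f ((univ.filter (fun i => ℓ i = Fin.castSucc c)).orderEmbOfFin rfl a)
            ((univ.filter (fun i => ℓ i = Fin.castSucc c)).orderEmbOfFin rfl b) := by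
  rw [prod_Ioi_eq_prod_pairs, ← prod_within_eq_prod_blocks,
    ← prod_filter_mul_prod_filter_not ((univ : Finset (Fin N × Fin N)).filter (fun p => p.1 < p.2))
      (fun p => ℓ p.1 = ℓ p.2 ∧ ℓ p.1 ≠ Fin.last m), filter_filter, filter_filter, mul_comm]

/-- **(A2) the bound**: for `0 ≤ f ≤ A`,
`∏_{j<k} f j k ≤ A^B · ∏_c ∏_{a<b} f (ι_c a) (ι_c b)` with `B = #{p : p.1 < p.2, ¬ within p}`. -/
theorem prod_Ioi_le_pow_mul_prod_blocks (ℓ : Fin N → Fin (m + 1)) (f : Fin N → Fin N → ℝ) {A : ℝ}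
    (hf0 : ∀ j k, 0 ≤ f j k) (hfA : ∀ j k, f j k ≤ A) :
    ∏ j : Fin N, ∏ k ∈ Ioi j, f j k ≤
      A ^ ((univ : Finset (Fin N × Fin N)).filter (fun p => p.1 < p.2 ∧ ¬ (ℓ p.1 = ℓ p.2 ∧ ℓ p.1 ≠ Fin.last m))).card *
        ∏ c : Fin m, ∏ a : Fin (univ.filter (fun i => ℓ i = Fin.castSucc c)).card, ∏ b ∈ Ioi a,
          f ((univ.filter (fun i => ℓ i = Fin.castSucc c)).orderEmbOfFin rfl a)
            ((univ.filter (fun i => ℓ i = Fin.castSucc c)).orderEmbOfFin rfl b) := by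
  rw [prod_Ioi_eq_rest_mul_blocks ℓ f]
  refine mul_le_mul_of_nonneg_right ?_ ?_
  · rw [← prod_const]
    exact prod_le_prod (fun p _ => hf0 _ _) fun p _ => hfA _ _
  · exact prod_nonneg fun c _ => prod_nonneg fun a _ => prod_nonneg fun b _ => hf0 _ _

/-! ### §4 Counting the rest: `B ≤ X + |K|·N` -/

/-- The pairs touching the collar number at most `|K|·N`. -/
theorem card_touching_collar_le (ℓ : Fin N → Fin (m + 1)) :
    ((univ : Finset (Fin N × Fin N)).filter
        (fun p => p.1 < p.2 ∧ (ℓ p.1 = Fin.last m ∨ ℓ p.2 = Fin.last m))).card ≤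
      (univ.filter (fun i => ℓ i = Fin.last m)).card * N := by
  classical
  set T := (univ : Finset (Fin N × Fin N)).filter (fun p => p.1 < p.2 ∧ (ℓ p.1 = Fin.last m ∨ ℓ p.2 = Fin.last m)) with hT
  -- send a pair to (its collar element, the other element)
  set g : Fin N × Fin N → Fin N × Fin N := fun p => if ℓ p.1 = Fin.last m then p else (p.2, p.1) with hg
  have hmaps : ∀ p ∈ T, g p ∈ univ.filter (fun i => ℓ i = Fin.last m) ×ˢ (univ : Finset (Fin N)) := by
    intro p hp
    simp only [hT, mem_filter, mem_univ, true_and] at hp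
    simp only [hg, mem_product, mem_filter, mem_univ, true_and, and_true]
    split_ifs with h1
    · exact h1
    · exact hp.2.resolve_left h1
  have hinj : Set.InjOn g T := by
    intro p hp p' hp' hpp'
    simp only [hT, coe_filter, mem_univ, true_and, Set.mem_setOf_eq] at hp hp'
    simp only [hg] at hpp'
    split_ifs at hpp' with h1 h2 h2
    · exact hpp'
    · -- p = (p'.2, p'.1): impossible by the orderings
      have ha : p.1 = p'.2 := congrArg Prod.fst hpp'
      have hb : p.2 = p'.1 := congrArg Prod.snd hpp'
      have : p.1 < p.2 := hp.1
      rw [ha, hb] at this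
      exact absurd (this.trans hp'.1) (lt_irrefl _)
    · have ha : p.2 = p'.1 := congrArg Prod.fst hpp'
      have hb : p.1 = p'.2 := congrArg Prod.snd hpp'
      have : p'.1 < p'.2 := hp'.1
      rw [← ha, ← hb] at this
      exact absurd (this.trans hp.1) (lt_irrefl _)
    · have ha : p.2 = p'.2 := congrArg Prod.fst hpp'
      have hb : p.1 = p'.1 := congrArg Prod.snd hpp'
      exact Prod.ext hb ha
  calc T.card ≤ (univ.filter (fun i => ℓ i = Fin.last m) ×ˢ (univ : Finset (Fin N))).card :=
        card_le_card_of_injOn g hmaps hinj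
    _ = (univ.filter (fun i => ℓ i = Fin.last m)).card * N := by
        rw [card_product, card_univ, Fintype.card_fin]

/-- **`B ≤ X + |K|·N`**: a non-within pair is either a labelled cross pair or touches the collar. -/
theorem card_not_within_le (ℓ : Fin N → Fin (m + 1)) :
    ((univ : Finset (Fin N × Fin N)).filter (fun p => p.1 < p.2 ∧ ¬ (ℓ p.1 = ℓ p.2 ∧ ℓ p.1 ≠ Fin.last m))).card ≤
      ((univ : Finset (Fin N × Fin N)).filter
          (fun p => p.1 < p.2 ∧ ℓ p.1 ≠ ℓ p.2 ∧ ℓ p.1 ≠ Fin.last m ∧ ℓ p.2 ≠ Fin.last m)).card +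
        (univ.filter (fun i => ℓ i = Fin.last m)).card * N := by
  classical
  refine le_trans ?_ (Nat.add_le_add_left (card_touching_collar_le ℓ) _)
  refine le_trans (card_le_card ?_) (card_union_le _ _)
  intro p hp
  simp only [mem_filter, mem_univ, true_and] at hp
  simp only [mem_union, mem_filter, mem_univ, true_and]
  obtain ⟨hlt, hnw⟩ := hp
  by_cases h1 : ℓ p.1 = Fin.last m
  · exact Or.inr ⟨hlt, Or.inl h1⟩
  · by_cases h2 : ℓ p.2 = Fin.last m
    · exact Or.inr ⟨hlt, Or.inr h2⟩
    · refine Or.inl ⟨hlt, ?_, h1, h2⟩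
      intro heq
      exact hnw ⟨heq, h1⟩

/-- The same bound in `ℝ` (for the exponent arithmetic). -/
theorem card_not_within_le_real (ℓ : Fin N → Fin (m + 1)) :
    (((univ : Finset (Fin N × Fin N)).filter (fun p => p.1 < p.2 ∧ ¬ (ℓ p.1 = ℓ p.2 ∧ ℓ p.1 ≠ Fin.last m))).card : ℝ) ≤
      (((univ : Finset (Fin N × Fin N)).filter
          (fun p => p.1 < p.2 ∧ ℓ p.1 ≠ ℓ p.2 ∧ ℓ p.1 ≠ Fin.last m ∧ ℓ p.2 ≠ Fin.last m)).card : ℝ) +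
        ((univ.filter (fun i => ℓ i = Fin.last m)).card : ℝ) * N := by
  exact_mod_cast card_not_within_le ℓ

/-- Block sizes add up with the collar: `Σ_c n_c + |K| = N`. -/
theorem sum_card_blocks_add_collar (ℓ : Fin N → Fin (m + 1)) :
    ∑ c : Fin m, (univ.filter (fun i => ℓ i = Fin.castSucc c)).card + (univ.filter (fun i => ℓ i = Fin.last m)).card = N := by
  have h := card_eq_sum_card_fiberwise (s := (univ : Finset (Fin N))) (t := (univ : Finset (Fin (m + 1)))) (f := ℓ)
    (fun _ _ => mem_univ _)
  rw [card_univ, Fintype.card_fin, Fin.sum_univ_castSucc] at h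
  exact h.symm

end PairPartition

end Summit.QuantumFields.YangMills.Theorems.EguchiKawaiDirectionLadder
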